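import Mathlib
import Summits.CriticalPhenomena.CardyFormulaZ2.Theses.CardyWhiteToColoured
import Summits.CriticalPhenomena.CardyFormulaZ2.Theorems.CardyWhiteToColouredNoiseDiscretisationStability
import Summits.CriticalPhenomena.CardyFormulaZ2.Theorems.CardyWhiteToColouredNoiseDiscretisationSignMeasurable
import Summits.CriticalPhenomena.CardyFormulaZ2.Theorems.CardyWhiteToColouredNoiseDiscretisationDiscrepancy
import Summits.CriticalPhenomena.CardyFormulaZ2.Theorems.CardyWhiteToColouredNoiseDiscretisationNoAtom

/-!
# `NoiseDiscretisation` (route CardyWhiteToColoured of `CardyFormulaZ2`, item stmt-CriticalPhenomena-4598)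

**Theorem** (`noiseDiscretisation_proof`, the route decl
`Summit.CriticalPhenomena.CardyFormulaZ2.Theses.CardyWhiteToColoured.NoiseDiscretisation`): for every
white noise `μ` on `𝒮'(ℂ)`, every Gaussian bump family `k`, every conformal rectangle `R` and
`ε > 0` there is `ℓ₀ > 0` (indeed `ℓ₀ = 1`) such that for every `0 < ℓ < ℓ₀` there is `δ₀ > 0` with
`|P^latt_{ℓ,δ}(R) − P^cont_ℓ(R)| < ε` for `0 < δ < δ₀`: the crossing probability of `R` at mesh `δ`
by the positive set of the lattice white noise on `E(ℤ²)` smoothed by the Gaussian kernel at scale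
`ℓ` (G02 discretisation: largest mesh component, discrete arcs) converges, as `δ → 0⁺` with `ℓ`
fixed, to the `μ`-probability that `closure R` is crossed from `arc 0` to `arc 2` by a path on
which the smoothed white noise `x ↦ ω (k ℓ x)` is positive (`tendsto_smoothedCrossingProb`).

Proof. (1) *Coupling* (`coupling`, file `…Discrepancy`): `ξ_e := ω(H_e)/N` for the smooth bumps
`H_e` of the pairwise disjoint medial cells realises the lattice white noise inside `μ`
(`μ ∘ Ξ_δ⁻¹ = ⨂ N(0,1)`), and uniformly over the `O(δ⁻²)` inner edges the rescaled smoothed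
lattice noise is `η`-close to the smoothed continuum noise outside an event of probability
`→ 0` (Gaussian tails from the `L²` estimate `O(δ² + δℓ)` of the discrepancy). (2) *Stability*
(`crossing_stability`, file `…Stability`): for a *robust* continuous field (a positive crossing, or
no crossing at some negative level) and small `δ`, the discrete crossing event of any edge function
`η`-close to the field on the inner edges coincides with the continuum crossing event (Schoenflies
normal form, lattice shadow and the Bollobás–Riordan sandwich stub of `LoopsToCrossings` for
continuum ⇒ discrete; polyline and nearest-arc segments for discrete ⇒ continuum). (3) *No atom*
(`ae_robust`, file `…NoAtom`): almost every smoothed white noise is robust (Gaussian shift along a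
test direction, independence, countable form of the crossing event, Fubini). (4) *Assembly*: along
any sequence of meshes a fast subsequence has summable bad-event probabilities (Borel–Cantelli), so
the indicators of the coupled lattice events converge a.e. to that of the continuum event, and the
probabilities converge (dominated convergence through a measurable proxy); the subsequence
principle gives the limit along `𝓝[>] 0`.

References: S. Muirhead, H. Vanneuville, Ann. Inst. H. Poincaré Probab. Stat. 56 (2020), §2.1,
Prop. 3.11; V. Beffara, D. Gayet, Publ. IHÉS 126 (2017), §1; S. Smirnov, C. R. Acad. Sci. Paris
333 (2001), §2.
-/

noncomputable section

namespace Summit.CriticalPhenomena.CardyFormulaZ2.Theorems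

namespace WhiteToColoured

open Set Metric Filter Topology MeasureTheory ProbabilityTheory
open Literature.Probability.LatticeModels Literature.Probability.Percolation
open Literature.Probability.RandomPlanarGeometry
open Literature.MathematicalPhysics.QuantumLattice

/-! ### Notation (shared verbatim with the helper files) -/

/-- `PosCross[R, F, c]`: some path in `closure R.carrier` from `arc 0` to `arc 2` has `F > c`. -/
local notation3 "PosCross[" R ", " F ", " c "]" =>
  ∃ x ∈ MarkedDomain.arc R (0 : Fin 4), ∃ y ∈ MarkedDomain.arc R (2 : Fin 4), ∃ γ : Path x y,
    ∀ t, γ t ∈ closure (JordanDomain.carrier (MarkedDomain.toJordanDomain R)) ∧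
      (c : ℝ) < (F : ℂ → ℝ) (γ t)

/-- `InnerE[Ω, δ]`: the inner lattice edges at mesh `δ` (both mesh end-points in `Ω`). -/
local notation3 "InnerE[" Ω ", " δ "]" =>
  {e : Sym2 (Site 2) | e ∈ (zdGraph 2).edgeSet ∧ ∀ v ∈ e, meshPoint δ v ∈ (Ω : Set ℂ)}

/-- `PosCfg[g]`: the bond configuration of positive values of the edge function `g`. -/
local notation3 "PosCfg[" g "]" =>
  {e : Sym2 (Site 2) | e ∈ (zdGraph 2).edgeSet ∧ (0 : ℝ) < (g : Sym2 (Site 2) → ℝ) e}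

/-- `Robust[R, F]`: a positive crossing exists, or no crossing survives some negative margin. -/
local notation3 "Robust[" R ", " F "]" =>
  (PosCross[R, F, 0] ∨ ∃ c : ℝ, 0 < c ∧ ¬ PosCross[R, F, -c])

/-! ### Assembly -/

/-- Pointwise key step: for a robust configuration, below the stability mesh and off the bad
set, the coupled lattice crossing event and the continuum crossing event agree. -/
theorem mem_iff_of_stable {R : ConformalRectangle} {k : ℝ → ℂ → SchwartzMap ℂ ℝ} {ℓ : ℝ}
    {ω : FieldConfig ℂ} {η δ₁ : ℝ}
    (hst : ∀ δ : ℝ, 0 < δ → δ < δ₁ → ∀ g : Sym2 (Site 2) → ℝ,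
      (∀ e ∈ InnerE[R.carrier, δ], |g e - (fun x => ω (k ℓ x)) (medialPoint δ e)| < η) →
      (PosCfg[g] ∈ discreteCrossing R.carrier δ (R.arc 0) (R.arc 2) ↔
        PosCross[R, fun x => ω (k ℓ x), 0]))
    {Ξ : ℝ → FieldConfig ℂ → ((zdGraph 2).edgeSet → ℝ)} {c : ℝ → ℝ} (hc : ∀ δ, 0 < δ → 0 < c δ)
    {δ : ℝ} (hδ : 0 < δ) (hδ₁ : δ < δ₁)
    (hgood : ¬ ∃ e ∈ InnerE[R.carrier, δ],
      η ≤ |c δ * smoothedNoise ℓ δ (Ξ δ ω) (medialPoint δ e) - ω (k ℓ (medialPoint δ e))|) :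
    ω ∈ (Ξ δ) ⁻¹' (signConfig ℓ δ ⁻¹' discreteCrossing R.carrier δ (R.arc 0) (R.arc 2)) ↔
      ω ∈ continuumCrossingEvent k ℓ R := by
  rw [mem_preimage, mem_preimage, signConfig_eq_posCfg, continuumCrossingEvent_eq_posCross,
    mem_setOf_eq, ← posCfg_const_mul (hc δ hδ)]
  refine hst δ hδ hδ₁ _ fun e he => ?_
  by_contra h
  exact hgood ⟨e, he, not_lt.1 h⟩

/-- Fixed-scale discretisation: `P^latt_{ℓ,δ}(R) → P^cont_ℓ(R)` as `δ → 0⁺`. -/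
theorem tendsto_smoothedCrossingProb {μ : Measure (FieldConfig ℂ)} (hμ : IsWhiteNoise μ)
    {k : ℝ → ℂ → SchwartzMap ℂ ℝ} (hk : IsGaussianBumpFamily k) (R : ConformalRectangle)
    {ℓ : ℝ} (hℓ : 0 < ℓ) :
    Tendsto (fun δ => smoothedCrossingProb ℓ δ R.carrier (R.arc 0) (R.arc 2)) (𝓝[>] 0)
      (𝓝 (continuumCrossingProb μ k ℓ R)) := by
  haveI : IsProbabilityMeasure μ := hμ.1.1.toIsProbabilityMeasure
  obtain ⟨Ξ, hΞm, hΞlaw, c, hc, hclose⟩ := coupling hμ hk hℓ R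
  set Ω := R.carrier with hΩ
  -- the coupled lattice events and the bad sets
  set As : ℝ → Set (FieldConfig ℂ) := fun δ =>
    (Ξ δ) ⁻¹' (signConfig ℓ δ ⁻¹' discreteCrossing Ω δ (R.arc 0) (R.arc 2)) with hAs
  set Bad : ℝ → ℝ → Set (FieldConfig ℂ) := fun η δ => {ω | ∃ e ∈ InnerE[Ω, δ],
    η ≤ |c δ * smoothedNoise ℓ δ (Ξ δ ω) (medialPoint δ e) - ω (k ℓ (medialPoint δ e))|}
    with hBad
  set E₂ : Set (FieldConfig ℂ) := continuumCrossingEvent k ℓ R with hE₂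
  have hAs_meas : ∀ δ, 0 < δ → MeasurableSet (As δ) := fun δ hδ =>
    (measurableSet_signConfig_preimage_discreteCrossing ℓ δ Ω (R.arc 0) (R.arc 2)).preimage
      (hΞm δ hδ)
  have hP : ∀ δ, 0 < δ → smoothedCrossingProb ℓ δ Ω (R.arc 0) (R.arc 2) = μ.real (As δ) := by
    intro δ hδ
    rw [smoothedCrossingProb, show latticeWhiteNoise = μ.map (Ξ δ) from (hΞlaw δ hδ).symm,
      measureReal_def, measureReal_def,
      Measure.map_apply (hΞm δ hδ) (measurableSet_signConfig_preimage_discreteCrossing ℓ δ Ω _ _)]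
  have hBad_mono : ∀ {η η' : ℝ} (δ : ℝ), η ≤ η' → Bad η' δ ⊆ Bad η δ := by
    intro η η' δ hle ω hω
    obtain ⟨e, he, h⟩ := hω
    exact ⟨e, he, hle.trans h⟩
  have hrob := ae_robust hμ hk hℓ R
  -- subsequence principle
  refine tendsto_of_subseq_tendsto fun ns hns => ?_
  rw [tendsto_nhdsWithin_iff] at hns
  obtain ⟨hns0, hnspos⟩ := hns
  -- extract a fast subsequence
  have hev : ∀ n : ℕ, ∀ᶠ m in atTop, μ (Bad (1 / ((n : ℝ) + 1)) (ns m)) ≤ (1 / 2 : ENNReal) ^ n := by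
    intro n
    have h1 : Tendsto (fun m => μ (Bad (1 / ((n : ℝ) + 1)) (ns m))) atTop (𝓝 0) :=
      (hclose (1 / ((n : ℝ) + 1)) (by positivity)).comp (tendsto_nhdsWithin_iff.2 ⟨hns0, hnspos⟩)
    have hpos : (0 : ENNReal) < (1 / 2 : ENNReal) ^ n := ENNReal.pow_pos (by norm_num) n
    exact (h1.eventually (gt_mem_nhds hpos)).mono fun m hm => hm.le
  obtain ⟨ms, hms, hms'⟩ := extraction_forall_of_eventually hev
  refine ⟨ms, ?_⟩
  set δ' : ℕ → ℝ := fun n => ns (ms n) with hδ'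
  have hδ'0 : Tendsto δ' atTop (𝓝 0) := hns0.comp hms.tendsto_atTop
  have hδ'pos : ∀ᶠ n in atTop, 0 < δ' n := hms.tendsto_atTop.eventually hnspos
  -- Borel–Cantelli
  have hBC : ∀ᵐ ω ∂μ, ∀ᶠ n : ℕ in atTop, ω ∉ Bad (1 / ((n : ℝ) + 1)) (δ' n) := by
    refine ae_eventually_notMem (ne_of_lt ?_)
    calc ∑' n : ℕ, μ (Bad (1 / ((n : ℝ) + 1)) (δ' n)) ≤ ∑' n : ℕ, (1 / 2 : ENNReal) ^ n :=
          ENNReal.tsum_le_tsum fun n => hms' n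
      _ = 2 := by rw [ENNReal.tsum_geometric]; norm_num
      _ < ⊤ := ENNReal.ofNat_lt_top
  -- almost sure eventual agreement of the events
  have hlim : ∀ᵐ ω ∂μ, ∀ᶠ n in atTop, ω ∈ As (δ' n) ↔ ω ∈ E₂ := by
    filter_upwards [hrob, hBC] with ω hω hωBC
    obtain ⟨η, hη, δ₁, hδ₁, hst⟩ := crossing_stability R (continuous_field hk hℓ ω) hω
    obtain ⟨N, hN⟩ := exists_nat_gt (1 / η)
    have hηN : ∀ n : ℕ, N ≤ n → 1 / ((n : ℝ) + 1) ≤ η := by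
      intro n hn
      rw [div_le_iff₀ (by positivity)]
      have h1 : 1 / η < (n : ℝ) + 1 := hN.trans_le (by exact_mod_cast Nat.le_succ_of_le hn)
      rw [div_lt_iff₀ hη] at h1
      linarith [mul_comm η ((n : ℝ) + 1)]
    filter_upwards [hωBC, hδ'pos, hδ'0.eventually (gt_mem_nhds hδ₁), eventually_ge_atTop N]
      with n hn hpos hlt hNn
    exact mem_iff_of_stable hst hc hpos hlt fun h => hn (hBad_mono (δ' n) (hηN n hNn) h)
  -- a measurable proxy for `E₂`
  set Bset : Set (FieldConfig ℂ) := ⋃ N : ℕ, ⋂ n : ℕ, ⋂ (_ : N ≤ n), (As (δ' n) ∩ {_ω | 0 < δ' n})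
    with hBset
  have hmem_Bset : ∀ ω, ω ∈ Bset ↔ ∀ᶠ n in atTop, ω ∈ As (δ' n) ∧ 0 < δ' n := by
    intro ω
    simp only [hBset, mem_iUnion, mem_iInter, mem_inter_iff, mem_setOf_eq, eventually_atTop]
  have hBset_meas : MeasurableSet Bset := by
    refine MeasurableSet.iUnion fun N => MeasurableSet.iInter fun n => MeasurableSet.iInter fun _ => ?_
    by_cases h : 0 < δ' n
    · rw [show (As (δ' n) ∩ {_ω : FieldConfig ℂ | 0 < δ' n}) = As (δ' n) from
        inter_eq_left.2 fun _ _ => h]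
      exact hAs_meas _ h
    · rw [show (As (δ' n) ∩ {_ω : FieldConfig ℂ | 0 < δ' n}) = ∅ from
        eq_empty_of_forall_notMem fun ω hω => h hω.2]
      exact MeasurableSet.empty
  have hlimB : ∀ᵐ ω ∂μ, ∀ᶠ n in atTop, ω ∈ As (δ' n) ↔ ω ∈ Bset := by
    filter_upwards [hlim] with ω hω
    have hiff : ω ∈ Bset ↔ ω ∈ E₂ := by
      rw [hmem_Bset]
      constructor
      · intro h
        obtain ⟨n, hn1, hn2⟩ := (h.and hω).exists
        exact hn2.1 hn1.1
      · intro h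
        filter_upwards [hω, hδ'pos] with n hn hpos
        exact ⟨hn.2 h, hpos⟩
    simp only [hiff]
    exact hω
  have hE₂B : E₂ =ᵐ[μ] Bset := by
    filter_upwards [hlim, hlimB] with ω h1 h2
    obtain ⟨n, hn1, hn2⟩ := (h1.and h2).exists
    exact propext (hn1.symm.trans hn2)
  have hT : Tendsto (fun n => μ (As (δ' n) ∩ {_ω | 0 < δ' n})) atTop (𝓝 (μ Bset)) := by
    refine tendsto_measure_of_ae_tendsto_indicator_of_isFiniteMeasure atTop hBset_meas
      (fun n => ?_) ?_
    · by_cases h : 0 < δ' n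
      · rw [show (As (δ' n) ∩ {_ω : FieldConfig ℂ | 0 < δ' n}) = As (δ' n) from
          inter_eq_left.2 fun _ _ => h]
        exact hAs_meas _ h
      · rw [show (As (δ' n) ∩ {_ω : FieldConfig ℂ | 0 < δ' n}) = ∅ from
          eq_empty_of_forall_notMem fun ω hω => h hω.2]
        exact MeasurableSet.empty
    · filter_upwards [hlimB] with ω hω
      filter_upwards [hω, hδ'pos] with n hn hpos
      rw [← hn, mem_inter_iff, mem_setOf_eq]
      exact ⟨fun h => h.1, fun h => ⟨h, hpos⟩⟩
  have hT' : Tendsto (fun n => μ.real (As (δ' n) ∩ {_ω | 0 < δ' n})) atTop (𝓝 (μ.real E₂)) := by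
    rw [measureReal_def, measure_congr hE₂B]
    exact (ENNReal.tendsto_toReal (measure_ne_top μ Bset)).comp hT
  refine hT'.congr' ?_
  filter_upwards [hδ'pos] with n hpos
  show μ.real (As (δ' n) ∩ {_ω | 0 < δ' n}) = smoothedCrossingProb ℓ (ns (ms n)) Ω (R.arc 0) (R.arc 2)
  rw [hP _ hpos, show (As (δ' n) ∩ {_ω : FieldConfig ℂ | 0 < δ' n}) = As (δ' n) from
    inter_eq_left.2 fun _ _ => hpos]

end WhiteToColoured

open WhiteToColoured Literature.Probability.Percolation Filter Topology in
/-- **Item `NoiseDiscretisation` of route CardyWhiteToColoured.** -/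
theorem noiseDiscretisation_proof :
    Summit.CriticalPhenomena.CardyFormulaZ2.Theses.CardyWhiteToColoured.NoiseDiscretisation := by
  intro μ hμG hμgen k hk R ε hε
  have hμ : IsWhiteNoise μ := ⟨hμG, hμgen⟩
  refine ⟨1, one_pos, fun ℓ hℓ _ => ?_⟩
  have ht := tendsto_smoothedCrossingProb hμ hk R hℓ
  rw [Metric.tendsto_nhds] at ht
  have hev := ht ε hε
  rw [eventually_nhdsWithin_iff, Metric.eventually_nhds_iff] at hev
  obtain ⟨δ₀, hδ₀, h⟩ := hev
  refine ⟨δ₀, hδ₀, fun δ hδ hδlt => ?_⟩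
  have := h (by simpa [Real.dist_eq, abs_of_pos hδ] using hδlt) hδ
  rw [Real.dist_eq] at this
  rw [← abs_smoothedCrossingProb_sub_continuumCrossingProb_eq]
  exact this

end Summit.CriticalPhenomena.CardyFormulaZ2.Theorems
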